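import Literature.NumberTheory.Automorphic.Liu2021.LemD1Item3AtVOfSeparation
import Literature.RepresentationTheory.MoeglinVignerasWaldspurger1987.RankOneThetaLiftSplitPlaceSeparation
import HarnessLib

/-!
# [Liu2021, Lem. D.1 (3)] AT A FINITE PLACE on the indexed family `localIndexedFamilyAtV`: the `(μ, χ)`-clauses (→) at a
# SPLIT place from the twist rigidity of rank-one theta lifts, through a line-model transport — THEOREMS ONLY

Topic `NumberTheory/Automorphic/Liu2021`; namespace `Literature.NumberTheory.Automorphic.Liu2021.Def411WeilCarriers` (the indexed
family `localIndexedFamilyAtV … v` of `Def411WeilCarriersLocalDataAtV.lean`).  The SPLIT-PLACE twin of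
`LemD1Item3AtVOfSeparation.lean` §3 (`sameClass_and_chi_eq_of_areIsomorphicRep_nonsplit_of_modelTransport`, non-split places,
conditional on IV-4c1), with the same transport currency.  KERNEL ONLY: theorems, no definition, no named fact, no `sorry`, debt
Δ 0; the split-place row IV-4c4 `rankOne_theta_twist_rigidity_split` (`RankOneThetaLiftTwistRigiditySplit.lean`, D-0014) enters as
the HYPOTHESIS `h4`, and the two analytic inputs that are not yet tree theorems enter as HYPOTHESES in the family's own currency:
* `hnt` — NON-VANISHING of the rank-one theta lift of member `j` at a split place (row IV-3(a)(b) through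
  `SplitPlace.splitPlace_model_consequences_of_facts`; transfer from that theorem's big-group shape by
  `nontrivial_thetaCoinv_of_modelTransport` below);
* `hK` — «TRANSPORTED-EQUAL SPLITTINGS ⇒ EQUAL `μ_v`» (Kudla's explicit sections determine `μ_v`; the cell's item F2
  `LocalKudlaSplittingUniqueness`): if the section of member `i`, line-transported onto member `j`'s line, EQUALS the section of
  member `j`, then `μ_{j,v} = μ_{i,v}`.

* §1 `nontrivial_thetaCoinv_of_modelTransport` — along a model transport `M : 𝒮(F_vᴺ) ≃ 𝒮(F_vⁿ)` intertwining `ω_s` with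
  `(𝓢_t).omegaLoc v ∘ (k ↦ k ⊗ 1)` (`hM`), the `χ_{t,v}`-coinvariants of `ω_s` under the centre of `U(J_V)` at ANY line `J₁` are
  non-zero iff those of `(𝓢_t).omegaLoc v` under the centre of `U(J_V ⊗ (a_t))` at `J₁` are (`localLineInl_localCenter`,
  `TwistedCoinv.mapEquiv`).
* §2 **`mu_and_chi_eq_of_areIsomorphicRep_split_of_modelTransport`** — `N = 3`, `E_v` NOT a field: under `h4`, `hnt`, `hK`,
  transports `(s_t, M_t)` for all members with `ω_{s_t}` smooth and `L²`-isometric, `AreIsomorphicRep (quot j) (quot i) →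
  mu j = mu i ∧ chi j = chi i` — the `μ`- and `χ`-summands of `LemD1_3AsPrintedI`'s right-hand side at a split place (the
  `ε`-summand is automatic there: `LemD1IndexedNonVacuityNonsplitPlace.sameClass_of_split`).  Proof: §2 of the non-split file for
  `i` and `j` (both members at the line `(a_j)`), `rankOne_theta_split_lineTransport_eq_and_char_eq_of_areIsomorphicRep`
  (`RankOneThetaLiftSplitPlaceSeparation.lean`: all lines are equivalent at a split place, then IV-4c4), `hK` for `μ`, and
  `localCharOfCenter_theta_eq` for `χ`.

Written for the cell `hodgecm-mathlib`, fan A line `a4-liuD3`, stub `stub_splitInjective` (`SplitInjective`: at `¬ IsField`,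
`Θ_j ≅ Θ_i → μ_j = μ_i ∧ χ_j = χ_i`): with B-p13's `lineTransportSection` (`LocalLineModelTransport.lean`) as `s_t`, `M_t = 1`,
the stub is this theorem modulo `h4` (named fact), `hnt` (rows IV-3(a)(b)) and `hK` (item F2).
HC_CM is proved only modulo the 7 printed citations (`hDel`, `h21`, `hLiu418`, `h411`, `h413`, `hD3`, `hD1''`) until rung 0 closes;
this file discharges none of them and no interface fact.

## References
* [Liu2021] Y. Liu, Camb. J. Math. 9 (2021) = arXiv:2102.11518 — App. D Lemma D.1 (3) (l. 5233) and its proof, split case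
  (l. 5249–5254: «We consider first the case where `E = F × F` …»).
* [Minguez2008] A. Mínguez, Ann. Sci. ÉNS 41 (2008) — Thm. 1 p. 718 (type II theta `(GL_1, GL_n)`).
* [MoeglinVignerasWaldspurger1987] C. Mœglin, M.-F. Vignéras, J.-L. Waldspurger, LNM 1291, Chap. 2 II.1, Chap. 3 I.1–I.3, IV.
* [Kudla1994] S. Kudla, Israel J. Math. 87 (1994), Thm. 3.1 (explicit splittings).
-/

set_option autoImplicit false

noncomputable section

open scoped Matrix Kronecker
open NumberField IsDedekindDomain
open _root_.MeasureTheory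
open Literature.NumberTheory.Automorphic Literature.NumberTheory.Automorphic.UnitaryGroup
open Literature.RepresentationTheory
open Literature.RepresentationTheory.HeisenbergGroup (MpPsi)
open Literature.NumberTheory.GelbartRogawski1991 Literature.NumberTheory.GelbartRogawski1991.UnitaryDualPair
open Literature.NumberTheory.GelbartRogawski1991.UnitaryDualPair.WeilCoinv
open Literature.NumberTheory.GelbartRogawski1991.UnitaryDualPair.LocalSplitting (iota LocalMp localSchrodinger)
open Literature.RepresentationTheory.MoeglinVignerasWaldspurger1987

namespace Literature.NumberTheory.Automorphic.Liu2021

namespace Def411WeilCarriers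

variable (F E : Type) [Field F] [NumberField F] [Field E] [NumberField E] [Algebra F E]
variable (c : E ≃ₐ[F] E) (N : ℕ) {n : ℕ} (e : Fin N × Fin 1 ≃ Fin n)
variable (JV : Matrix (Fin N) (Fin N) E) {TV : Matrix (Fin N) (Fin N) F}
variable [Algebra.IsQuadraticExtension F E] {δ : E} (hcδ : c δ = -δ) (hδ : δ ≠ 0) {d : F} (hd : δ * δ = algebraMap F E d)

omit [NumberField F] [NumberField E] [Algebra.IsQuadraticExtension F E] in
/-- `2 ≤ N` when `3 ≤ n` (`N = n` along `e`; plumbing). [folklore] -/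
private theorem two_le_rank₃' (e : Fin N × Fin 1 ≃ Fin n) (hn : 3 ≤ n) : 2 ≤ N := by
  have := Fintype.card_congr e; simp only [Fintype.card_prod, Fintype.card_fin, mul_one] at this; omega

/-! ## §1 Non-vanishing transfers along a model transport -/

/-- **Non-vanishing along a line-model transport.**  Let member `t` of `localIndexedFamilyAtV … v` come with a section
`s : U(J_V)(F_v) →* LocalMp F N T_V v` and a linear equivalence `M : 𝒮(F_vᴺ) ≃ 𝒮(F_vⁿ)` intertwining `ω_s` with
`(𝓢_t).omegaLoc v ∘ (k ↦ k ⊗ 1)` (`hM`).  For every line `J₁` presenting the centre: if the `χ_{t,v}`-coinvariants of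
`(𝓢_t).omegaLoc v` under the centre of `U(J_V ⊗ (a_t))` at `J₁` are non-zero (the shape delivered at a split place by
`SplitPlace.splitPlace_model_consequences_of_facts`), then so are the `χ_{t,v}`-coinvariants of `ω_s` under the centre of
`U(J_V)` at `J₁` (`k ↦ k ⊗ 1` carries centre to centre, `localLineInl_localCenter`; `M` descends, `TwistedCoinv.mapEquiv`).
[cite: MoeglinVignerasWaldspurger1987, Chap. 3 IV.2] [cite: Liu2021, App. D §D.1 Step 3 (l. 5221)] -/
theorem nontrivial_thetaCoinv_of_modelTransport (hV : TV.IsSymm) (hJV : JV = TV.map (algebraMap F E))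
    {ι : Type} (aOf : ι → Fˣ) (χOf : ι → Chi F E c)
    (𝓢Of : ∀ i, LocalSplitting.FinLocalSplittings F E c n hcδ hδ hd (gram F e TV (TW F (aOf i))) (isSymm_gram F e hV (isSymm_TW F (aOf i)))
      (reindex_kronecker_eq_gram_map F E e hJV (JW_eq F E (aOf i))))
    (v : HeightOneSpectrum (𝓞 F)) (t : ι)
    (s : localPi E c N JV v →* LocalMp F N TV v)
    (M : SchwartzBruhat (Fin N → v.adicCompletion F) ≃ₗ[ℂ] SchwartzBruhat (Fin n → v.adicCompletion F))
    (hM : ∀ (g : localPi E c N JV v) (Φ : SchwartzBruhat (Fin N → v.adicCompletion F)),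
      M (((MpPsi.toRep (localSchrodinger F N TV v)).comp s) g Φ) =
        (show Representation ℂ (localPi E c N JV v) (SchwartzBruhat (Fin n → v.adicCompletion F)) from
          ((𝓢Of t).omegaLoc v).comp (localLineInl E c N e JV (JW F E (aOf t)) v)) g (M Φ))
    (J₁ : Matrix (Fin 1) (Fin 1) E) (hJ₁ : J₁ 0 0 ≠ 0)
    (hnt : Nontrivial (TwistedCoinv.Coinv
      (show Representation ℂ (localPi E c 1 J₁ v) (SchwartzBruhat (Fin n → v.adicCompletion F)) from
        ((𝓢Of t).omegaLoc v).comp (localCenter E c n (Matrix.reindex e e (JV ⊗ₖ JW F E (aOf t))) J₁ hJ₁ v))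
      (localCharOfCenter F E c J₁ hJ₁ (χOf t).1 v))) :
    Nontrivial (TwistedCoinv.Coinv
      (show Representation ℂ (localPi E c 1 J₁ v) (SchwartzBruhat (Fin N → v.adicCompletion F)) from
        ((MpPsi.toRep (localSchrodinger F N TV v)).comp s).comp (localCenter E c N JV J₁ hJ₁ v))
      (localCharOfCenter F E c J₁ hJ₁ (χOf t).1 v)) := by
  refine (TwistedCoinv.mapEquiv
    (show Representation ℂ (localPi E c 1 J₁ v) (SchwartzBruhat (Fin N → v.adicCompletion F)) from
      ((MpPsi.toRep (localSchrodinger F N TV v)).comp s).comp (localCenter E c N JV J₁ hJ₁ v))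
    (localCharOfCenter F E c J₁ hJ₁ (χOf t).1 v)
    (show Representation ℂ (localPi E c 1 J₁ v) (SchwartzBruhat (Fin n → v.adicCompletion F)) from
      ((𝓢Of t).omegaLoc v).comp (localCenter E c n (Matrix.reindex e e (JV ⊗ₖ JW F E (aOf t))) J₁ hJ₁ v))
    (localCharOfCenter F E c J₁ hJ₁ (χOf t).1 v) M (fun _ => 1) (fun z Φ => ?_)
    (fun _ => (one_mul _).symm)).toEquiv.nontrivial_congr.mpr hnt
  rw [Units.val_one, one_smul]
  change (𝓢Of t).omegaLoc v (localCenter E c n (Matrix.reindex e e (JV ⊗ₖ JW F E (aOf t))) J₁ hJ₁ v z) (M Φ) =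
    M ((MpPsi.toRep (localSchrodinger F N TV v)) (s (localCenter E c N JV J₁ hJ₁ v z)) Φ)
  rw [← localLineInl_localCenter E c N e JV (JW F E (aOf t)) J₁ hJ₁ v z]
  exact (hM (localCenter E c N JV J₁ hJ₁ v z) Φ).symm

/-! ## §2 [Lem. D.1 (3)] AS PRINTED on `localIndexedFamilyAtV … v`, `(μ, χ)`-clauses (→), `N = 3`, SPLIT `v` — from the twist
rigidity of rank-one theta lifts (`rankOne_theta_split_lineTransport_eq_and_char_eq_of_areIsomorphicRep`, conditional on row
IV-4c4), Kudla's local injectivity (`hK`) and split-place non-vanishing (`hnt`) -/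

section Three

variable {n : ℕ} (e : Fin 3 × Fin 1 ≃ Fin n) (JV : Matrix (Fin 3) (Fin 3) E) {TV : Matrix (Fin 3) (Fin 3) F}

/-- **[Liu2021, App. D Lem. D.1 (3)], `(μ, χ)`-CLAUSES (→ direction) AT A SPLIT PLACE on the indexed family
`localIndexedFamilyAtV … v` of §D.1's data for `V` itself (`N = 3`), CONDITIONAL on the named fact IV-4c4
`rankOne_theta_twist_rigidity_split`, THROUGH LINE-MODEL TRANSPORTS.**  Hypotheses: `h4`; `E_v` NOT a field (`hE`); a Haar
measure `μ'` on `F_v`; for every member `t`, a trace-zero `δ'_t` (`δ'_t² = d'_t`), a SECTION `s_t : U(J_V)(F_v) →* LocalMp F 3 T_V v`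
over `ι_{δ'_t}` (`hs`) with `ω_{s_t}` smooth (`hsm`) and `L²(μ'³)`-isometric (`hL2`), and a linear equivalence
`M_t : 𝒮(F_v³) ≃ 𝒮(F_vⁿ)` intertwining `ω_{s_t}` with `(𝓢_t).omegaLoc v ∘ (k ↦ k ⊗ 1)` (`hM`) — the `e′_a` transport for
`e = Equiv.prodUnique`, `δ'_t = a_t⁻¹ δ`, `M_t = 1`; NON-VANISHING of `Θ_{s_j}(χ_{j,v})` (`hnt`, at the line `(a_j)`; rows
IV-3(a)(b) at a split place, via `nontrivial_thetaCoinv_of_modelTransport`); and KUDLA'S LOCAL INJECTIVITY in transported form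
(`hK`: if `s_i` line-transported onto the line `δ'_j` equals `s_j`, then `μ_{j,v} = μ_{i,v}`).  THEN
«`ω(μ_j, ε_j, χ_j) ≅ ω(μ_i, ε_i, χ_i)`» (`AreIsomorphicRep (quot j) (quot i)`, READING L7) forces `μ_{j,v} = μ_{i,v}` (`mu j = mu i`)
AND `χ_j = χ_i` (`chi j = chi i`) — the literal `μ`- and `χ`-summands of `LemD1_3AsPrintedI`'s right-hand side.  Proof: §2 of
`LemD1Item3AtVOfSeparation` for `i` and `j` (both members at the line `(a_j)`) puts them in the currency of
`rankOne_theta_split_lineTransport_eq_and_char_eq_of_areIsomorphicRep` (all lines equivalent at a split place, then IV-4c4):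
`s_j` is the line transport of `s_i` and `χ_{j,v} = χ_{i,v}` at `(a_j)`; `hK` reads the first as `μ_{j,v} = μ_{i,v}`, the
characters agree on `S.normOne` by `localCharOfCenter_theta_eq`.
[cite: Liu2021, App. D Lemma D.1 (3) (l. 5233) and proof, split case (l. 5249–5254)] [cite: Minguez2008, Thm. 1 p. 718]
[cite: MoeglinVignerasWaldspurger1987, Chap. 3 IV.4] [cite: Kudla1994, Thm. 3.1] -/
theorem mu_and_chi_eq_of_areIsomorphicRep_split_of_modelTransport (h4 : rankOne_theta_twist_rigidity_split)
    (hV : TV.IsSymm) (hVd : IsUnit TV.det) (hJV : JV = TV.map (algebraMap F E))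
    (hn : 3 ≤ n) {ι : Type} (aOf : ι → Fˣ) (χOf : ι → Chi F E c)
    (𝓢Of : ∀ i, LocalSplitting.FinLocalSplittings F E c n hcδ hδ hd (gram F e TV (TW F (aOf i))) (isSymm_gram F e hV (isSymm_TW F (aOf i)))
      (reindex_kronecker_eq_gram_map F E e hJV (JW_eq F E (aOf i))))
    (μOf : ι → ∀ v : HeightOneSpectrum (𝓞 F), (LocalRing E v)ˣ →* ℂˣ) (hμn : ∀ i v x, ‖((μOf i v x : ℂˣ) : ℂ)‖ = 1)
    (hμc : ∀ i v, Continuous fun x => ((μOf i v x : ℂˣ) : ℂ))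
    (hμF : ∀ (i : ι) (v : HeightOneSpectrum (𝓞 F)) (t : (v.adicCompletion F)ˣ),
      μOf i v (Units.map (algebraMap (v.adicCompletion F) (LocalRing E v)).toMonoidHom t) = 1 ↔
        ∃ x : (LocalRing E v)ˣ, (x : LocalRing E v) * conjLocal E c v x = algebraMap (v.adicCompletion F) (LocalRing E v) t)
    (v : HeightOneSpectrum (𝓞 F)) (hE : ¬ IsField (LocalRing E v))
    [MeasurableSpace (v.adicCompletion F)] [BorelSpace (v.adicCompletion F)]
    (μ' : Measure (v.adicCompletion F)) [μ'.IsAddHaarMeasure] (i j : ι)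
    (δ' : ι → E) (hcδ' : ∀ t, c (δ' t) = -δ' t) (hδ' : ∀ t, δ' t ≠ 0) (d' : ι → F)
    (hd' : ∀ t, δ' t * δ' t = algebraMap F E (d' t))
    (s : ι → (localPi E c 3 JV v →* LocalMp F 3 TV v))
    (hs : ∀ t g, MpPsi.proj _ (s t g) = iota F E c 3 (hcδ' t) (hδ' t) (hd' t) TV hV hJV v g)
    (hsm : ∀ t, Representation.IsSmooth ((MpPsi.toRep (localSchrodinger F 3 TV v)).comp (s t)))
    (hL2 : ∀ t, Representation.IsL2Isometric (Measure.pi fun _ : Fin 3 => μ')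
      ((MpPsi.toRep (localSchrodinger F 3 TV v)).comp (s t)))
    (M : ι → (SchwartzBruhat (Fin 3 → v.adicCompletion F) ≃ₗ[ℂ] SchwartzBruhat (Fin n → v.adicCompletion F)))
    (hM : ∀ (t : ι) (g : localPi E c 3 JV v) (Φ : SchwartzBruhat (Fin 3 → v.adicCompletion F)),
      M t (((MpPsi.toRep (localSchrodinger F 3 TV v)).comp (s t)) g Φ) =
        (show Representation ℂ (localPi E c 3 JV v) (SchwartzBruhat (Fin n → v.adicCompletion F)) from
          ((𝓢Of t).omegaLoc v).comp (localLineInl E c 3 e JV (JW F E (aOf t)) v)) g (M t Φ))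
    (hnt : Nontrivial (TwistedCoinv.Coinv
      (show Representation ℂ (localPi E c 1 (JW F E (aOf j)) v) (SchwartzBruhat (Fin 3 → v.adicCompletion F)) from
        ((MpPsi.toRep (localSchrodinger F 3 TV v)).comp (s j)).comp
          (localCenter E c 3 JV (JW F E (aOf j)) (JW_apply_ne_zero F E (aOf j)) v))
      (localCharOfCenter F E c (JW F E (aOf j)) (JW_apply_ne_zero F E (aOf j)) (χOf j).1 v)))
    (hK : (∃ (x : (LocalRing E v)ˣ) (hx : algebraMap E (LocalRing E v) (δ' j) =
        (x : LocalRing E v) * conjLocal E c v x * algebraMap E (LocalRing E v) (δ' i)),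
        lineTransportSplitting E v c 3 (hcδ' i) (hδ' i) (hd' i) (hcδ' j) (hδ' j) (hd' j) x TV hV hVd hx (s i) = s j) →
      μOf j v = μOf i v)
    (hiso : AreIsomorphicRep
      ((localIndexedFamilyAtV F E c 3 e JV hcδ hδ hd hV hVd hJV hn aOf χOf 𝓢Of μOf hμn hμc hμF v).quot j)
      ((localIndexedFamilyAtV F E c 3 e JV hcδ hδ hd hV hVd hJV hn aOf χOf 𝓢Of μOf hμn hμc hμF v).quot i)) :
    (localIndexedFamilyAtV F E c 3 e JV hcδ hδ hd hV hVd hJV hn aOf χOf 𝓢Of μOf hμn hμc hμF v).mu j =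
        (localIndexedFamilyAtV F E c 3 e JV hcδ hδ hd hV hVd hJV hn aOf χOf 𝓢Of μOf hμn hμc hμF v).mu i ∧
      (localIndexedFamilyAtV F E c 3 e JV hcδ hδ hd hV hVd hJV hn aOf χOf 𝓢Of μOf hμn hμc hμF v).chi j =
        (localIndexedFamilyAtV F E c 3 e JV hcδ hδ hd hV hVd hJV hn aOf χOf 𝓢Of μOf hμn hμc hμF v).chi i := by
  have hJh : (JV.map c)ᵀ = JV := transpose_map_conj_JV F E c 3 JV hV hJV
  have hJdet : JV.det ≠ 0 := det_JV_ne_zero F E 3 JV hVd hJV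
  -- unitarity and continuity of the local components `χ_{t,v}` at the line `(a_j)`
  have hχu : ∀ t z, ‖((localCharOfCenter F E c (JW F E (aOf j)) (JW_apply_ne_zero F E (aOf j)) (χOf t).1 v z : ℂˣ) : ℂ)‖ = 1 :=
    fun t => norm_localCharOfCenter F E c (JW F E (aOf j)) (JW_apply_ne_zero F E (aOf j))
      (norm_chi_eq_one F E c (Algebra.IsQuadraticExtension.finrank_eq_two F E)
        (UnitaryGroup.algEquiv_ne_one_of_apply_eq_neg F E c hcδ hδ) (χOf t)) v
  have hχc : ∀ t, Continuous fun z => ((localCharOfCenter F E c (JW F E (aOf j)) (JW_apply_ne_zero F E (aOf j)) (χOf t).1 v z : ℂˣ) : ℂ) :=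
    fun t => continuous_coe_localCharOfCenter F E c (JW F E (aOf j)) (JW_apply_ne_zero F E (aOf j)) (χOf t).2.1 v
  -- (a) both members in the currency of the separation theorem, at the common line `(a_j)`
  have hj := areIsomorphicRep_theta_comp_uEquiv_quot F E c 3 e JV hcδ hδ hd hV hVd hJV hn aOf χOf 𝓢Of μOf hμn hμc hμF v j
    (s j) (M j) (hM j) (JW F E (aOf j)) (JW_apply_ne_zero F E (aOf j))
  have hi := areIsomorphicRep_theta_comp_uEquiv_quot F E c 3 e JV hcδ hδ hd hV hVd hJV hn aOf χOf 𝓢Of μOf hμn hμc hμF v i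
    (s i) (M i) (hM i) (JW F E (aOf j)) (JW_apply_ne_zero F E (aOf j))
  have hisoY := AreIsomorphicRep.of_comp_surjective _
    (LemD1OfPlace.uEquiv E v c 3 JV hcδ hδ (two_le_rank₃' 3 e hn) hJh hJdet).surjective ((hj.trans hiso).trans hi.symm)
  -- (b) all lines are equivalent at a split place, then IV-4c4: `s_j` is the line transport of `s_i`, and `χ_{j,v} = χ_{i,v}`
  obtain ⟨htr, hχ⟩ := rankOne_theta_split_lineTransport_eq_and_char_eq_of_areIsomorphicRep h4 F E c
    (δ' j) (hcδ' j) (hδ' j) (d' j) (hd' j) (δ' i) (hcδ' i) (hδ' i) (d' i) (hd' i) TV hV hVd JV hJV v hE μ'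
    (s j) (s i) (hs j) (hs i) (hsm j) (hsm i) (hL2 j) (hL2 i)
    (JW F E (aOf j)) (JW_apply_ne_zero F E (aOf j))
    (localCharOfCenter F E c (JW F E (aOf j)) (JW_apply_ne_zero F E (aOf j)) (χOf j).1 v)
    (localCharOfCenter F E c (JW F E (aOf j)) (JW_apply_ne_zero F E (aOf j)) (χOf i).1 v)
    (hχu j) (hχc j) (hχu i) (hχc i) hnt hisoY
  refine ⟨?_, ?_⟩
  · -- (μ) Kudla's local injectivity, transported form
    exact Subtype.ext (hK htr)
  · -- (χ) `χ_{j,v} = χ_{i,v}` at the line `(a_j)` ⟹ `χ_j ∘ θ_{(a_j)} = χ_i ∘ θ_{(a_i)}` on `E_v¹`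
    refine Subtype.ext (MonoidHom.ext fun z => ?_)
    change localCharOfCenter F E c (JW F E (aOf j)) (JW_apply_ne_zero F E (aOf j)) (χOf j).1 v
        (LemD1OfPlace.theta E v c 3 JV hcδ hδ _ _ _ (JW F E (aOf j)) z) =
      localCharOfCenter F E c (JW F E (aOf i)) (JW_apply_ne_zero F E (aOf i)) (χOf i).1 v
        (LemD1OfPlace.theta E v c 3 JV hcδ hδ _ _ _ (JW F E (aOf i)) z)
    rw [hχ, localCharOfCenter_theta_eq F E c 3 JV hcδ hδ _ _ _ v (JW F E (aOf j)) (JW F E (aOf i))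
      (JW_apply_ne_zero F E (aOf j)) (JW_apply_ne_zero F E (aOf i)) (χOf i).1 z]

end Three

end Def411WeilCarriers

end Literature.NumberTheory.Automorphic.Liu2021

end
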